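import Summits.CriticalPhenomena.SAWScalingLimit.Theorems.SAWTotalPositivityBoundaryTP2Defs
import Summits.CriticalPhenomena.SAWScalingLimit.Theorems.EdgeOfPositivity.Negative.EdgeOfPositivityRectDomain
import HarnessLib

/-!
# Crux `BoundaryTP2` (stmt-CriticalPhenomena-7115), line `Sketch`: the odd sector of the 3-row strip transfer

Tool stub `stub_strip3_oddCone` of the line's skeleton (lead c6).  On the 3-row strip
`S_L = {0,…,L} × {0,1,2}` the last-column transfer recursion for the self-avoiding path kernels from the
corner `(0,0)` splits under the top–bottom reflection; its ODD sector is the pair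
`D_L = Z((0,0),(L,0)) - Z((0,0),(L,2))`, `R_L = PP_L(0;0) - PP_L(0;2)` (difference of the two
disjoint-pair kernels), driven by

  `D_{L+1} = x(1-x²) D_L - x⁴ R_L`,   `R_{L+1} = x² D_L + x³ R_L`,   `(D_0, R_0) = (1-x², x)`.

The eigenvalues of this `2 × 2` map are `x(1 ± √(1-4x²))/2`, real exactly for `x ≤ 1/2`.  Here the pure
real statement: for `0 ≤ x ≤ 1/2` the cone `0 ≤ R ≤ 2D` is invariant and contains the initial vector, so
`D_L ≥ 0` for every `L` — the corner/facing inequality `Z((0,0),(L,2)) ≤ Z((0,0),(L,0))` on every 3-row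
strip (the lead's bridge file instantiates `D`, `R` with the kernels).  Elementary real algebra only.
-/

noncomputable section

namespace Summit.CriticalPhenomena.SAWScalingLimit.Theorems.BoundaryTP2

open Literature.Probability.LatticeModels Literature.Probability.RandomPlanarGeometry
open Summit.CriticalPhenomena.SAWScalingLimit.Theorems.EdgeOfPositivity.Negative
open scoped ENNReal

/-- **Tool stub `stub_strip3_oddCone`** (odd sector of the 3-row strip transfer). For `0 ≤ x ≤ 1/2`,
every pair of real sequences with `D_{L+1} = x(1-x²)D_L - x⁴R_L`, `R_{L+1} = x²D_L + x³R_L`,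
`D_0 = 1-x²`, `R_0 = x` stays in the cone `0 ≤ R_L ≤ 2 D_L`; in particular `D_L ≥ 0` for all `L`.
Invariance: `D' ≥ xD(1 - x² - 2x³) ≥ 0`, `R' ≥ 0`, and `R' ≤ 2D'` reduces, using `R ≤ 2D`, to
`x(4x³ + 4x² + x - 2) ≤ 0`, true exactly up to `x = 1/2`. [folklore] -/
theorem stub_strip3_oddCone {x : ℝ} (hx0 : 0 ≤ x) (hx : x ≤ 1 / 2) (D R : ℕ → ℝ)
    (hD0 : D 0 = 1 - x ^ 2) (hR0 : R 0 = x)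
    (hD : ∀ L, D (L + 1) = x * (1 - x ^ 2) * D L - x ^ 4 * R L)
    (hR : ∀ L, R (L + 1) = x ^ 2 * D L + x ^ 3 * R L) :
    ∀ L, 0 ≤ D L ∧ 0 ≤ R L ∧ R L ≤ 2 * D L := by
  have hx2 : x ^ 2 ≤ 1 / 4 := by nlinarith
  have hx3 : 0 ≤ x ^ 3 := pow_nonneg hx0 3
  have hx4 : 0 ≤ x ^ 4 := pow_nonneg hx0 4
  -- the cubic `4x³ + 4x² + x - 2 ≤ 0` on `[0, 1/2]`
  have hcubic : 4 * x ^ 3 + 4 * x ^ 2 + x - 2 ≤ 0 := by nlinarith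
  intro L
  induction L with
  | zero =>
    refine ⟨by rw [hD0]; nlinarith, by rw [hR0]; exact hx0, ?_⟩
    rw [hR0, hD0]; nlinarith
  | succ L ih =>
    obtain ⟨hDL, hRL, hRD⟩ := ih
    have hD' : x * (1 - x ^ 2) * D L - x ^ 4 * R L ≥ x * D L * (1 - x ^ 2 - 2 * x ^ 3) := by
      nlinarith [mul_le_mul_of_nonneg_left hRD hx4]
    have hpos : 0 ≤ 1 - x ^ 2 - 2 * x ^ 3 := by nlinarith
    refine ⟨?_, ?_, ?_⟩
    · rw [hD]
      exact le_trans (mul_nonneg (mul_nonneg hx0 hDL) hpos) hD'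
    · rw [hR]; positivity
    · rw [hR, hD]
      -- `x²D + x³R ≤ 2x(1-x²)D - 2x⁴R`, from `R ≤ 2D` and the cubic
      have h1 : R L * (x ^ 3 + 2 * x ^ 4) ≤ 2 * D L * (x ^ 3 + 2 * x ^ 4) :=
        mul_le_mul_of_nonneg_right hRD (by positivity)
      have h2 : D L * (x * (4 * x ^ 3 + 4 * x ^ 2 + x - 2)) ≤ 0 :=
        mul_nonpos_of_nonneg_of_nonpos hDL (mul_nonpos_of_nonneg_of_nonpos hx0 hcubic)
      nlinarith [h1, h2]

end Summit.CriticalPhenomena.SAWScalingLimit.Theorems.BoundaryTP2
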